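import Literature.Computability.Cryptography.LiuPassCondRedProgram
import HarnessLib

/-!
# The generator of Liu–Pass Thm 5.5 is polynomial time (discharge of `condGen_polyTime`)

`LiuPassCondFromRegular.lean` proves Liu–Pass's Thm 5.5 (FOCS 2020, arXiv:2009.11514: cond EP-PRGs
from one-way functions) from Lemma 5.3 (`liuPass_lemma53`) and two efficiency facts;
`LiuPassCondRedProgram.lean` discharges the reduction's. This file discharges the generator's,
`condGen_polyTime_holds : condGen_polyTime`: for a polynomial-time family `(i, w) ↦ f'_i(w)` (index
in unary) and a polynomial-time `GL`, the generator `CondParams.G` — find the designed prefix length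
`seedLen n ≤ |u|` (`n = nOfS |u|`), read the `⌊log₂ n⌋ + 1`-bit index field, call `f'_i` and `GL` on
the Lemma-5.3 seed, force both parts to their nominal lengths `ℓ n`, `γ'⌊log₂ n⌋`, pass the remaining
seed bits through and cut to `|u| + γ⌊log₂ |u|⌋` — is polynomial-time computable. With both
efficiency facts discharged, **Thm 5.5 follows from Lemma 5.3 alone**
(`condEPPRG_of_OWFExist_of_lemma53'`).

As in `YaoFunProgram.lean` no machine is programmed: `G` is a pipeline of `FP` bricks
(`PlumbingBricks.lean`, `HashBricks.umulFn`, `binToUnaryFn`, `Kannan.zerosFn`, and the unary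
logarithm / seed-length bricks `CondRed.logU`, `CondRed.seedU`, `CondRed.innerU` of
`LiuPassCondRedProgram.lean`) around one clocked loop:

* `CondGen.nOfU u = 1^{nOfS |u|}`: `|u|` rounds of "increment `k` while `seedLen (k+1) ≤ |u|`"
  (`srchRound`, model `srchN`; correct because `seedLen` is strictly increasing, `srchN_self`);
* `CondGen.GF`: the pipeline; `CondGen.GF_apply`: it computes `CondParams.G` (for `c ≥ 1`);
* `condGen_polyTime_holds`, `condEPPRG_of_OWFExist_of_lemma53'`.

## References

* Y. Liu, R. Pass, *On one-way functions and Kolmogorov complexity*, FOCS 2020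
  (arXiv:2009.11514), proof of Thm 5.5 (running time of `G'_{δ,γ}`: "`poly(n) + O(n^{c+1}) +
  (γ+δ)O(n^c log n)`"; "`G'_{δ,γ}(x')` finds a prefix `x` of `x'` as long as possible such that
  `|x|` is of the form `n'`").
* S. Arora, B. Barak, *Computational Complexity: A Modern Approach*, CUP 2009, §1.3, §1.4.1.
-/

namespace Literature.Computability.Cryptography

open _root_.Computability Polynomial Complexity Complexity.Brick Complexity.Plumb Complexity.OracleCompose

namespace CondGen

open CondRed

variable (Q : CondParams)

/-! ### The block length `nOfS |u|` by a clocked search -/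

/-- The search condition `[seedLen (k+1) ≤ |u|]` on the state `⟨u, 1ᵏ⟩`. [folklore] -/
noncomputable def srchCond : List Bool → List Bool :=
  lenLeFn X ∘ fanoutFn fstF (seedU Q.c ∘ List.cons true ∘ sndF)

/-- One round of the search: `k ↦ k + 1` while `seedLen (k+1) ≤ |u|`. [folklore] -/
noncomputable def srchRound : List Bool → List Bool :=
  fanoutFn fstF (iteFn (srchCond Q) (List.cons true ∘ sndF) sndF)

/-- The model of the search: `i` rounds from `k = 0` at seed length `N`. [folklore] -/
def srchN (N : ℕ) : ℕ → ℕ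
  | 0 => 0
  | i + 1 => if Q.seedLen (srchN N i + 1) ≤ N then srchN N i + 1 else srchN N i

/-- **`nOfU u = 1^{nOfS |u|}`**: `|u|` rounds of the search from `⟨u, ε⟩`. [Y. Liu, R. Pass, FOCS 2020,
proof of Thm 5.5 ("finds a prefix as long as possible such that `|x|` is of the form `n'`")] [folklore] -/
noncomputable def nOfU : List Bool → List Bool :=
  sndF ∘ (fun S => (srchRound Q)^[(X : Polynomial ℕ).eval (boolUnpair S).1.length] S) ∘ fanoutFn id (fun _ => [])

variable {Q}

/-- Value of the search condition on a state. [folklore] -/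
theorem srchCond_state (u : List Bool) (k : ℕ) :
    srchCond Q (boolPair u (ones k)) = [decide (Q.seedLen (k + 1) ≤ u.length)] := by
  simp only [srchCond, Function.comp_apply, fanoutFn_apply, fstF_boolPair, sndF_boolPair, true_cons_ones, seedU_apply,
    List.length_replicate, lenLeFn_boolPair, eval_X]

/-- Value of the search round on a state. [folklore] -/
theorem srchRound_state (u : List Bool) (k : ℕ) :
    srchRound Q (boolPair u (ones k)) = boolPair u (ones (if Q.seedLen (k + 1) ≤ u.length then k + 1 else k)) := by
  unfold srchRound
  rw [fanoutFn_apply, fstF_boolPair]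
  congr 1
  by_cases h : Q.seedLen (k + 1) ≤ u.length
  · rw [iteFn_apply_true (by rw [srchCond_state, decide_eq_true h]), if_pos h]
    simp [true_cons_ones]
  · rw [iteFn_apply_false (by rw [srchCond_state, decide_eq_false h]), if_neg h]
    simp

/-- Additive growth of the search round, on every word. [folklore] -/
theorem length_srchRound_le (S : List Bool) : (srchRound Q S).length ≤ S.length + 3 := by
  have h1 := length_fstF_sndF_le S
  unfold srchRound
  rcases lenLeFn_eq_or X (fanoutFn fstF (seedU Q.c ∘ List.cons true ∘ sndF) S) with h | h
  · rw [fanoutFn_apply, iteFn_apply_true (by simpa [srchCond] using h)]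
    simp only [length_boolPair, Function.comp_apply, List.length_cons]
    omega
  · rw [fanoutFn_apply, iteFn_apply_false (by simpa [srchCond] using h)]
    simp only [length_boolPair]
    omega

/-- The rounds follow the model. [folklore] -/
theorem iterate_srchRound (u : List Bool) : ∀ i : ℕ,
    (srchRound Q)^[i] (boolPair u []) = boolPair u (ones (srchN Q u.length i))
  | 0 => rfl
  | i + 1 => by
    rw [Function.iterate_succ_apply', iterate_srchRound u i, srchRound_state]
    rfl

/-- The model stays on admissible block lengths and stops only when the next one does not fit.
[folklore] -/
theorem srchN_spec {N : ℕ} (h0 : Q.seedLen 0 ≤ N) : ∀ i : ℕ,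
    Q.seedLen (srchN Q N i) ≤ N ∧ (srchN Q N i = i ∨ N < Q.seedLen (srchN Q N i + 1))
  | 0 => ⟨h0, Or.inl rfl⟩
  | i + 1 => by
    obtain ⟨h1, h2⟩ := srchN_spec h0 i
    simp only [srchN]
    split_ifs with h
    · refine ⟨h, Or.inl ?_⟩
      rcases h2 with h2 | h2
      · rw [h2]
      · exact absurd h (not_le.2 h2)
    · exact ⟨h1, Or.inr (not_le.1 h)⟩

/-- Below `seedLen 0` the model never moves. [folklore] -/
theorem srchN_eq_zero {N : ℕ} (h0 : N < Q.seedLen 0) : ∀ i : ℕ, srchN Q N i = 0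
  | 0 => rfl
  | i + 1 => by
    have ih := srchN_eq_zero h0 i
    have hlt : ¬ Q.seedLen (srchN Q N i + 1) ≤ N := by
      rw [ih]; exact not_le.2 (h0.trans_le (Q.seedLen_strictMono.monotone (Nat.zero_le 1)))
    show (if Q.seedLen (srchN Q N i + 1) ≤ N then srchN Q N i + 1 else srchN Q N i) = 0
    rw [if_neg hlt, ih]

/-- **After `N` rounds the model is `nOfS N`.** [folklore] -/
theorem srchN_self (hc : 1 ≤ Q.c) (N : ℕ) : srchN Q N N = Q.nOfS N := by
  rcases le_or_gt (Q.seedLen 0) N with h0 | h0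
  · obtain ⟨h1, h2⟩ := srchN_spec (Q := Q) h0 N
    have h2' : N < Q.seedLen (srchN Q N N + 1) := by
      rcases h2 with h2 | h2
      · rw [h2]; exact Nat.lt_of_lt_of_le (Nat.lt_succ_self N) (Q.le_seedLen (N + 1))
      · exact h2
    exact (Q.nOfS_eq hc h1 h2').symm
  · rw [srchN_eq_zero h0 N]
    symm
    unfold CondParams.nOfS
    rw [Nat.findGreatest_eq_zero_iff]
    intro n _ _
    exact not_le.2 (h0.trans_le (Q.seedLen_strictMono.monotone (Nat.zero_le n)))

/-- **`nOfU u = 1^{nOfS |u|}`.** [folklore] -/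
theorem nOfU_apply (hc : 1 ≤ Q.c) (u : List Bool) : nOfU Q u = ones (Q.nOfS u.length) := by
  have h := iterate_srchRound (Q := Q) u u.length
  simp only [nOfU, Function.comp_apply, fanoutFn_apply, id, boolUnpair_boolPair, eval_X]
  rw [h, sndF_boolPair, srchN_self hc]

/-- `srchRound ∈ FP`. [folklore] -/
theorem srchRound_mem_FP : srchRound Q ∈ FP :=
  fanoutFn_mem_FP fstF_mem_FP (iteFn_mem_FP
    (comp_mem_FP (lenLeFn_mem_FP X) (fanoutFn_mem_FP fstF_mem_FP
      (comp_mem_FP (seedU_mem_FP _) (comp_mem_FP (cons_mem_FP true) sndF_mem_FP))))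
    (comp_mem_FP (cons_mem_FP true) sndF_mem_FP) sndF_mem_FP)

/-- **`nOfU ∈ FP`** (a clocked loop of additive growth, `iterate_mem_FP`). [folklore] -/
theorem nOfU_mem_FP : nOfU Q ∈ FP :=
  comp_mem_FP sndF_mem_FP (comp_mem_FP (iterate_mem_FP srchRound_mem_FP 3 length_srchRound_le X)
    (fanoutFn_mem_FP OracleCompose.id_mem_FP (const_mem_FP _)))

/-! ### The generator as a pipeline -/

variable (Q)

/-- `1^{seedLen n}`, `n = nOfS |u|`. [folklore] -/
noncomputable def sLenU : List Bool → List Bool := seedU Q.c ∘ nOfU Q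
/-- `1^{⌊log₂ n⌋}`. [folklore] -/
noncomputable def lgU : List Bool → List Bool := logU ∘ nOfU Q
/-- `1^{b n}`, `b n = ⌊log₂ n⌋ + 1` (width of the index field). [folklore] -/
noncomputable def bU : List Bool → List Bool := List.cons true ∘ lgU Q
/-- The designed prefix `v = u ↾ seedLen n`. [folklore] -/
noncomputable def vF : List Bool → List Bool := takeFn ∘ fanoutFn (sLenU Q) id
/-- The pass-through part `u ⇂ seedLen n`. [folklore] -/
noncomputable def restF : List Bool → List Bool := dropFn ∘ fanoutFn (sLenU Q) id
/-- The index field `v ↾ b n`. [folklore] -/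
noncomputable def idxF : List Bool → List Bool := takeFn ∘ fanoutFn (bU Q) (vF Q)
/-- Lemma 5.3's seed `w = v ⇂ b n`. [folklore] -/
noncomputable def wF : List Bool → List Bool := dropFn ∘ fanoutFn (bU Q) (vF Q)
/-- The index in unary `1ⁱ`, `i = bitsToNat (v ↾ b n) < 2^{b n} ≤ 2n + 2`. [folklore] -/
noncomputable def iU : List Bool → List Bool := binToUnaryFn ∘ fanoutFn (polyFn (2 * X + C 2) ∘ nOfU Q) (idxF Q)
/-- `1^{ℓ n}`, `ℓ n = (n - ⌊log₂ n⌋ - 1) + 3n^c - 2α'⌊log₂ n⌋`. [folklore] -/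
noncomputable def ellU : List Bool → List Bool :=
  dropFn ∘ fanoutFn (HashBricks.umulFn ∘ fanoutFn (fun _ => ones (2 * Q.α')) (lgU Q))
    (concatFn ∘ fanoutFn (dropFn ∘ fanoutFn (bU Q) (nOfU Q)) (polyFn (C 3 * X ^ Q.c) ∘ nOfU Q))
/-- `1^{γ' ⌊log₂ n⌋}`. [folklore] -/
noncomputable def glU : List Bool → List Bool := HashBricks.umulFn ∘ fanoutFn (fun _ => ones Q.γ') (lgU Q)
/-- `fitF len val u = fitLen (val u) |len u|` (truncate or pad with zeros). [folklore] -/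
noncomputable def fitF (len val : List Bool → List Bool) : List Bool → List Bool :=
  takeFn ∘ fanoutFn len (concatFn ∘ fanoutFn val (Kannan.zerosFn ∘ len))
/-- The family `(i, w) ↦ f'_i(w)` as a string function on `⟨1ⁱ, w⟩`. [folklore] -/
def fStr : List Bool → List Bool := fun z => Q.F (boolUnpair z).1.length (boolUnpair z).2
/-- `f'_i(w)`. [folklore] -/
noncomputable def fPart : List Bool → List Bool := fStr Q ∘ fanoutFn (iU Q) (wF Q)
/-- `Gcore n v = fitLen (f'_i w) (ℓ n) ‖ fitLen (GL w) (γ'⌊log₂ n⌋)`. [folklore] -/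
noncomputable def gcoreF : List Bool → List Bool :=
  concatFn ∘ fanoutFn (fitF (ellU Q) (fPart Q)) (fitF (glU Q) (Q.Hc ∘ wF Q))
/-- **The generator `G` as a pipeline**: `(Gcore n v ‖ rest) ↾ lpInner γ |u|`. [Y. Liu, R. Pass,
FOCS 2020, proof of Thm 5.5] [folklore] -/
noncomputable def GF : List Bool → List Bool :=
  takeFn ∘ fanoutFn (innerU Q.γ) (concatFn ∘ fanoutFn (gcoreF Q) (restF Q))

variable {Q}

/-- `fitF len val ∈ FP`. [folklore] -/
theorem fitF_mem_FP {len val : List Bool → List Bool} (hl : len ∈ FP) (hv : val ∈ FP) : fitF len val ∈ FP :=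
  comp_mem_FP takeFn_mem_FP (fanoutFn_mem_FP hl (comp_mem_FP concatFn_mem_FP
    (fanoutFn_mem_FP hv (comp_mem_FP Kannan.zerosFn_mem_FP hl))))

/-- Value of `fitF`. [folklore] -/
theorem fitF_apply (len val : List Bool → List Bool) (u : List Bool) :
    fitF len val u = CondParams.fitLen (val u) (len u).length := by
  simp [fitF, CondParams.fitLen]

/-- `lgU ∈ FP`. [folklore] -/
theorem lgU_mem_FP : lgU Q ∈ FP := comp_mem_FP logU_mem_FP nOfU_mem_FP
/-- `bU ∈ FP`. [folklore] -/
theorem bU_mem_FP : bU Q ∈ FP := comp_mem_FP (cons_mem_FP true) lgU_mem_FP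
/-- `sLenU ∈ FP`. [folklore] -/
theorem sLenU_mem_FP : sLenU Q ∈ FP := comp_mem_FP (seedU_mem_FP _) nOfU_mem_FP
/-- `vF ∈ FP`. [folklore] -/
theorem vF_mem_FP : vF Q ∈ FP := comp_mem_FP takeFn_mem_FP (fanoutFn_mem_FP sLenU_mem_FP OracleCompose.id_mem_FP)
/-- `restF ∈ FP`. [folklore] -/
theorem restF_mem_FP : restF Q ∈ FP := comp_mem_FP dropFn_mem_FP (fanoutFn_mem_FP sLenU_mem_FP OracleCompose.id_mem_FP)
/-- `idxF ∈ FP`. [folklore] -/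
theorem idxF_mem_FP : idxF Q ∈ FP := comp_mem_FP takeFn_mem_FP (fanoutFn_mem_FP bU_mem_FP vF_mem_FP)
/-- `wF ∈ FP`. [folklore] -/
theorem wF_mem_FP : wF Q ∈ FP := comp_mem_FP dropFn_mem_FP (fanoutFn_mem_FP bU_mem_FP vF_mem_FP)
/-- `iU ∈ FP`. [folklore] -/
theorem iU_mem_FP : iU Q ∈ FP :=
  comp_mem_FP binToUnaryFn_mem_FP (fanoutFn_mem_FP (comp_mem_FP (polyFn_mem_FP _) nOfU_mem_FP) idxF_mem_FP)
/-- `ellU ∈ FP`. [folklore] -/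
theorem ellU_mem_FP : ellU Q ∈ FP :=
  comp_mem_FP dropFn_mem_FP (fanoutFn_mem_FP
    (comp_mem_FP HashBricks.umulFn_mem_FP (fanoutFn_mem_FP (const_mem_FP _) lgU_mem_FP))
    (comp_mem_FP concatFn_mem_FP (fanoutFn_mem_FP (comp_mem_FP dropFn_mem_FP (fanoutFn_mem_FP bU_mem_FP nOfU_mem_FP))
      (comp_mem_FP (polyFn_mem_FP _) nOfU_mem_FP))))
/-- `glU ∈ FP`. [folklore] -/
theorem glU_mem_FP : glU Q ∈ FP :=
  comp_mem_FP HashBricks.umulFn_mem_FP (fanoutFn_mem_FP (const_mem_FP _) lgU_mem_FP)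
/-- `GF ∈ FP` for polynomial-time `f'` and `GL`. [folklore] -/
theorem GF_mem_FP (hF : fStr Q ∈ FP) (hH : Q.Hc ∈ FP) : GF Q ∈ FP :=
  comp_mem_FP takeFn_mem_FP (fanoutFn_mem_FP (innerU_mem_FP _) (comp_mem_FP concatFn_mem_FP (fanoutFn_mem_FP
    (comp_mem_FP concatFn_mem_FP (fanoutFn_mem_FP
      (fitF_mem_FP ellU_mem_FP (comp_mem_FP hF (fanoutFn_mem_FP iU_mem_FP wF_mem_FP)))
      (fitF_mem_FP glU_mem_FP (comp_mem_FP hH wF_mem_FP))))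
    restF_mem_FP)))

/-! #### Values -/

/-- `2^{b n} ≤ 2n + 2`: the index field never encodes more than `2n + 1`. [folklore] -/
theorem two_pow_b_le (n : ℕ) : 2 ^ CondParams.b n ≤ 2 * n + 2 := by
  unfold CondParams.b
  rcases Nat.eq_zero_or_pos n with rfl | hn
  · simp
  · have := Nat.pow_log_le_self 2 hn.ne'
    rw [pow_succ]
    omega

/-- **The pipeline computes the generator** (for `c ≥ 1`, where `nOfS` is the clocked search).
[Y. Liu, R. Pass, FOCS 2020, proof of Thm 5.5] [folklore] -/
theorem GF_apply (hc : 1 ≤ Q.c) (u : List Bool) : GF Q u = Q.G u := by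
  set n := Q.nOfS u.length with hn
  have hN : nOfU Q u = ones n := nOfU_apply hc u
  have hlg : lgU Q u = ones (Nat.log 2 n) := by simp only [lgU, Function.comp_apply, hN, logU_apply, List.length_replicate]
  have hb : bU Q u = ones (CondParams.b n) := by
    simp only [bU, Function.comp_apply, hlg, true_cons_ones, CondParams.b]
  have hsl : sLenU Q u = ones (Q.seedLen n) := by
    simp only [sLenU, Function.comp_apply, hN, seedU_apply, List.length_replicate]
  have hv : vF Q u = u.take (Q.seedLen n) := by
    simp only [vF, Function.comp_apply, fanoutFn_apply, hsl, id, takeFn_boolPair, List.length_replicate]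
  have hrest : restF Q u = u.drop (Q.seedLen n) := by
    simp only [restF, Function.comp_apply, fanoutFn_apply, hsl, id, dropFn_boolPair, List.length_replicate]
  have hidx : idxF Q u = (u.take (Q.seedLen n)).take (CondParams.b n) := by
    simp only [idxF, Function.comp_apply, fanoutFn_apply, hb, hv, takeFn_boolPair, List.length_replicate]
  have hw : wF Q u = (u.take (Q.seedLen n)).drop (CondParams.b n) := by
    simp only [wF, Function.comp_apply, fanoutFn_apply, hb, hv, dropFn_boolPair, List.length_replicate]
  have hruler : (polyFn (2 * X + C 2) (nOfU Q u)).length = 2 * n + 2 := by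
    rw [hN, polyFn_apply, List.length_replicate, List.length_replicate, eval_add, eval_mul, eval_ofNat, eval_X, eval_C]
  have hi : iU Q u = ones (bitsToNat ((u.take (Q.seedLen n)).take (CondParams.b n))) := by
    have h1 : iU Q u = ones (min (bitsToNat (idxF Q u)) (polyFn (2 * X + C 2) (nOfU Q u)).length) := by
      simp only [iU, Function.comp_apply, fanoutFn_apply, binToUnaryFn_boolPair]
    have hle : bitsToNat ((u.take (Q.seedLen n)).take (CondParams.b n)) ≤ 2 * n + 2 :=
      Nat.le_of_lt ((bitsToNat_lt _).trans_le
        ((Nat.pow_le_pow_right (by norm_num) (List.length_take_le _ _)).trans (two_pow_b_le n)))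
    rw [h1, hruler, hidx, Nat.min_eq_left hle]
  have hpc : polyFn (C 3 * X ^ Q.c) (ones n) = ones (3 * n ^ Q.c) := by
    rw [polyFn_apply, List.length_replicate, eval_mul, eval_C, eval_pow, eval_X]
  have hell : ellU Q u = ones (Q.ℓ n) := by
    have h1 : ellU Q u = ((ones n).drop (CondParams.b n) ++ ones (3 * n ^ Q.c)).drop (2 * Q.α' * Nat.log 2 n) := by
      simp only [ellU, Function.comp_apply, fanoutFn_apply, hlg, hb, hN, hpc, HashBricks.umulFn_boolPair, dropFn_boolPair,
        List.length_replicate, concatFn_boolPair]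
    rw [h1, Com.drop_ones, Com.ones_append, Com.drop_ones]
    unfold CondParams.ℓ lpLen53 lpS53 CondParams.b
    exact congrArg ones (by omega)
  have hgl : glU Q u = ones (Q.γ' * Nat.log 2 n) := by
    simp only [glU, Function.comp_apply, fanoutFn_apply, hlg, HashBricks.umulFn_boolPair]
  have hf : fPart Q u = Q.F (bitsToNat ((u.take (Q.seedLen n)).take (CondParams.b n))) ((u.take (Q.seedLen n)).drop (CondParams.b n)) := by
    simp only [fPart, fStr, Function.comp_apply, fanoutFn_apply, hi, hw, boolUnpair_boolPair, List.length_replicate]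
  have hcore : gcoreF Q u = Q.Gcore n (u.take (Q.seedLen n)) := by
    simp only [gcoreF, Function.comp_apply, fanoutFn_apply, fitF_apply, hell, hgl, hf, hw, List.length_replicate,
      concatFn_boolPair, CondParams.Gcore]
  simp only [GF, Function.comp_apply, fanoutFn_apply, innerU_apply, hcore, hrest, concatFn_boolPair, takeFn_boolPair,
    List.length_replicate, CondParams.G, padGen, hn]

end CondGen

/-! ### The discharge of `condGen_polyTime` and Thm 5.5 from Lemma 5.3 alone -/

/-- **Discharge of `condGen_polyTime`**: the generator `G` of Thm 5.5 (`CondParams.G`) is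
polynomial-time computable for a polynomial-time family `f'` (index in unary) and polynomial-time
`GL` — the `FP` pipeline `CondGen.GF`. Print: "`G'_{δ,γ}` runs in `poly(n) + O(n^{c+1}) +
(γ+δ)O(n^c log n)` time". [Y. Liu, R. Pass, FOCS 2020, proof of Thm 5.5 (running time)]
[cite: LiuPassFOCS2020, Thm 5.5 (proof)] -/
theorem condGen_polyTime_holds : condGen_polyTime := by
  intro Q hc hF hH
  have hF' : CondGen.fStr Q ∈ FP := hF
  have hH' : Q.Hc ∈ FP := hH
  have hGF : CondGen.GF Q ∈ FP := CondGen.GF_mem_FP hF' hH'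
  have heq : Q.G = CondGen.GF Q := by
    funext u
    exact (CondGen.GF_apply hc u).symm
  show Q.G ∈ FP
  rw [heq]
  exact hGF

/-- **Liu–Pass Thm 5.5 from Lemma 5.3 alone**: `liuPass_lemma53 → condEPPRG_of_OWFExist`, both
efficiency facts of `LiuPassCondFromRegular.lean` being discharged (`condGen_polyTime_holds`,
`condRedRun_polyTime_holds`). [Y. Liu, R. Pass, FOCS 2020, Thm 5.5] [cite: LiuPassFOCS2020, Thm 5.5] -/
theorem condEPPRG_of_OWFExist_of_lemma53' (h53 : liuPass_lemma53) : condEPPRG_of_OWFExist :=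
  condEPPRG_of_OWFExist_of_lemma53 h53 condGen_polyTime_holds condRedRun_polyTime_holds

end Literature.Computability.Cryptography
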